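import Summits.BirchSwinnertonDyer.BirchSwinnertonDyer.Theorems.KolyvaginRoadThreePTDescentAdjoint
import Summits.BirchSwinnertonDyer.BirchSwinnertonDyer.Theorems.KolyvaginRoadThreePTDescentSemiLocal
import Summits.BirchSwinnertonDyer.BirchSwinnertonDyer.Theorems.KolyvaginRoadThreePTSylowField
import Summits.BirchSwinnertonDyer.BirchSwinnertonDyer.Theorems.KolyvaginRoadThreePTUnipotentOfPGroup
import HarnessLib

/-!
# Milne *ADT* I Thm. 4.10(b) `Ker γ¹ ⊆ Im β¹` for every finite discrete `Γ_K`-module of order `p²`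
# killed by `p` (`p` odd) — in particular `E[p]`

Route `KolyvaginRoadThree`, crux `ZhangSharpFrameAtThreeHL` (stmt-BirchSwinnertonDyer-19574): the END of
the PT road for the module the line consumes (`MEMO-v9-PT-DEVISSAGE-g18.md`, `PT-ROAD-DESIGN-g19.md`).
For a number field `K`, an odd prime `p`, and a finite discrete `Γ_K`-module `M` with `p · M = 0` and
`#M = p²`, Poitou–Tate middle-exactness — for every finite set of places `S` off which `p` and `M` are
unramified, every family `t = (t_v)_{v ∈ S}` of local classes orthogonal, for THE local Tate pairings
(`LocalInvariants.canonical K p`), to the localisations of the classes of `M^D` unramified outside `S`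
comes from a global class unramified outside `S` — holds UNCONDITIONALLY
(`middleExact_canonical_of_card_eq_sq`).  Assembly:

1. `U := ker(Γ_K → Aut M × Aut μₚ)` is open normal; the fixed field `K'' = K̄^H` of a `p`-Sylow of
   `Γ_K/U` has `p ∤ [K'' : K]` and `res(Γ_{K''})` acts on `M` and on `μₚ` through elements of `p`-power
   order (`exists_fixedField_coprime_pow_mem'`, `KolyvaginRoadThreePTSylowField`);
2. hence `μₚ ⊂ K''` (an automorphism of `p`-power order of a group of order `p` is trivial —
   `IsPGroup` fixed points) and `M|_{Γ_{K''}}` is an extension of two trivial modules of order `p`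
   (`exists_unipotentTwo_data`, `KolyvaginRoadThreePTUnipotentOfPGroup`);
3. Milne I 4.10(b) over `K''` for every admissible `S''` (`middleExact_canonical_of_unipotentTwo_all`:
   the dévissage and the Kummer/Brauer inputs for `μₚ`, `ℤ/p`);
4. the prime-to-`p` DESCENT `K'' → K` (`middleExact_canonical_of_descentData`) with its nine binders —
   semi-local formulas (`localization_cor_eq_sum_localCor`, `…_globalCorDual_…`), degree
   (`sum_localCor_localRes`), adjointness (`localTatePairingZMod_localRes_eq_localCorDual`), unramified
   (`localCor(Dual)_mem_unramifiedSubgroup`), places, infinite places — all theorems.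

THEOREMS only; no named fact; no case of BSD.  What this is NOT: not Poitou–Tate for a general module
(only order `p²`, `p` odd), not the nine-term sequence, not `Im ⊆ Ker` (that half, `∑ inv_v = 0`, is the
tree's `sumLocalTermEqZero_canonical`).

References: [MilneADT2006] I Thm. 4.10(b); [SerreGaloisCohomology1997] I §2.4, II §6;
[CasselsFrohlichANT1967] IV §6, VII; [NeukirchSchmidtWingberg2008] (8.6.10).
-/

noncomputable section

open CategoryTheory Function NumberField IsDedekindDomain Field
open scoped NumberField ContRepresentation Classical

set_option linter.dupNamespace false
set_option autoImplicit false

namespace Summit.BirchSwinnertonDyer.BirchSwinnertonDyer.Theorems.KolyvaginRoadThreePT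

open Literature.NumberTheory.GaloisRepresentations Literature.NumberTheory.GaloisCohomology
open Literature.NumberTheory.GaloisRepresentations.DiscreteGaloisModule (mu MuCarrier TateDual tateDual
  unramifiedSubgroup localTatePairingZMod homOfIntertwining)
open Literature.NumberTheory.GaloisRepresentations.SemiLocal (Place)

/-! ## §1 An automorphism of `p`-power order of a group of order `p` is trivial -/

section PrimeOrder

variable {p : ℕ} [hp : Fact p.Prime]

/-- If a `p`-group acts on a set of size `p` with a fixed point, it acts trivially (the number of fixed
points is `≡ p (mod p)` and positive). [cite: SerreLocalFields1979, IX §1 Thm. 1] -/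
theorem mem_fixedPoints_of_card_eq_prime {G α : Type*} [Group G] [MulAction G α] [Finite α]
    (hG : IsPGroup p G) (hα : Nat.card α = p) {a : α} (ha : a ∈ MulAction.fixedPoints G α) (x : α) :
    x ∈ MulAction.fixedPoints G α := by
  by_contra hx
  have hmod := hG.card_modEq_card_fixedPoints α
  rw [hα] at hmod
  have hlt : Nat.card (MulAction.fixedPoints G α) < p := by
    rw [← hα, Nat.card_coe_set_eq]
    refine lt_of_le_of_ne (Set.ncard_le_card _) fun h => hx ?_
    rw [(Set.eq_univ_iff_ncard _).mpr h]
    exact Set.mem_univ x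
  have hpos : 0 < Nat.card (MulAction.fixedPoints G α) := by
    rw [Nat.card_coe_set_eq, Set.ncard_pos]
    exact ⟨a, ha⟩
  have hdvd : p ∣ Nat.card (MulAction.fixedPoints G α) :=
    Nat.modEq_zero_iff_dvd.mp (hmod.symm.trans (Nat.modEq_zero_iff_dvd.mpr dvd_rfl))
  exact absurd (Nat.le_of_dvd hpos hdvd) (not_le.mpr hlt)

/-- **An additive automorphism of `p`-power order of an abelian group of order `p` is the identity.**
[cite: SerreLocalFields1979, IX §1 Thm. 1] -/
theorem units_apply_eq_self_of_pow_eq_one {A : Type*} [AddCommGroup A] [Finite A] (hA : Nat.card A = p)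
    (u : (Module.End ℤ A)ˣ) {k : ℕ} (hu : u ^ (p ^ k) = 1) (a : A) : (u : Module.End ℤ A) a = a := by
  have hG : IsPGroup p (Subgroup.zpowers u) := by
    obtain ⟨j, -, hj⟩ := (Nat.dvd_prime_pow hp.out).mp (orderOf_dvd_of_pow_eq_one hu)
    exact IsPGroup.of_card (by rw [Nat.card_zpowers, hj])
  have h0 : (0 : A) ∈ MulAction.fixedPoints (Subgroup.zpowers u) A := fun g => by
    change ((g : (Module.End ℤ A)ˣ) : Module.End ℤ A) 0 = 0
    exact map_zero _
  exact mem_fixedPoints_of_card_eq_prime hG hA h0 a ⟨u, Subgroup.mem_zpowers u⟩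

end PrimeOrder

/-! ## §2 The open normal subgroup `U = ker(Γ_K → Aut M × Aut μₚ)` -/

section Kernel

variable {K : Type} [Field K] {M : Type} [AddCommGroup M] [TopologicalSpace M] [DiscreteTopology M]
  [Finite M] {p : ℕ} [NeZero p] (ρ : DiscreteGaloisModule K M)

/-- `U := ker(Γ_K → Aut_ℤ(M) × Aut_ℤ(μₚ))`. [cite: SerreGaloisCohomology1997, II §1.1] -/
def jointKer : Subgroup (absoluteGaloisGroup K) :=
  (ρ.toRepresentation.asGroupHom.prod (mu K p).toRepresentation.asGroupHom).ker

omit [Finite M] [NeZero p] in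
/-- Membership in `U`: `σ` acts trivially on `M` and on `μₚ`. [cite: SerreGaloisCohomology1997, II §1.1] -/
theorem mem_jointKer_iff (σ : absoluteGaloisGroup K) :
    σ ∈ jointKer (p := p) ρ ↔ (∀ m : M, ρ σ m = m) ∧ ∀ z : MuCarrier K p, mu K p σ z = z := by
  rw [jointKer, MonoidHom.mem_ker, MonoidHom.prod_apply, Prod.mk_eq_one]
  constructor
  · rintro ⟨h1, h2⟩
    refine ⟨fun m => ?_, fun z => ?_⟩
    · have := congrArg (fun u : (Module.End ℤ M)ˣ => (u : Module.End ℤ M) m) h1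
      simpa [Representation.asGroupHom_apply] using this
    · have := congrArg (fun u : (Module.End ℤ (MuCarrier K p))ˣ => (u : Module.End ℤ (MuCarrier K p)) z) h2
      simpa [Representation.asGroupHom_apply] using this
  · rintro ⟨h1, h2⟩
    exact ⟨Units.ext (LinearMap.ext fun m => by rw [Representation.asGroupHom_apply]; exact h1 m),
      Units.ext (LinearMap.ext fun z => by rw [Representation.asGroupHom_apply]; exact h2 z)⟩

variable [CharZero K]

/-- `U` is open (finitely many open stabilisers). [cite: SerreGaloisCohomology1997, II §1.1] -/
theorem isOpen_jointKer : IsOpen ((jointKer (p := p) ρ : Subgroup (absoluteGaloisGroup K)) :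
    Set (absoluteGaloisGroup K)) := by
  haveI : Finite (MuCarrier K p) :=
    Nat.finite_of_card_ne_zero (by rw [natCard_muCarrier]; exact NeZero.ne p)
  have h : ((jointKer (p := p) ρ : Subgroup (absoluteGaloisGroup K)) : Set (absoluteGaloisGroup K)) =
      (⋂ m : M, {σ | ρ σ m = m}) ∩ ⋂ z : MuCarrier K p, {σ | mu K p σ z = z} := by
    ext σ
    rw [SetLike.mem_coe, mem_jointKer_iff, Set.mem_inter_iff, Set.mem_iInter, Set.mem_iInter]
    exact Iff.rfl
  rw [h]
  exact (isOpen_iInter_of_finite fun m => ρ.isOpen_setOf_apply_eq m).inter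
    (isOpen_iInter_of_finite fun z => (mu K p).isOpen_setOf_apply_eq z)

end Kernel


/-! ## §3 The `p`-Sylow fixed field, with the property of `H` itself -/

section SylowField

variable {K : Type} [Field K] [CharZero K] {p : ℕ} [hp : Fact p.Prime]

/-- Variant of `exists_fixedField_coprime_pow_mem` also recording that every element of `H` itself has a
`p`-power power in `U` (used to see that `μₚ ⊂ K̄^H`). [cite: NeukirchANT1999, Ch. IV §1 Thm. (1.2)] -/
theorem exists_fixedField_coprime_pow_mem' (U : Subgroup (absoluteGaloisGroup K)) [U.Normal]
    (hU : IsOpen (U : Set (absoluteGaloisGroup K))) :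
    ∃ (H : Subgroup (absoluteGaloisGroup K)) (_ : IsOpen (H : Set (absoluteGaloisGroup K))),
      p.Coprime (Module.finrank K (IntermediateField.fixedField H : IntermediateField K (AlgebraicClosure K))) ∧
      (∀ h ∈ H, ∃ k : ℕ, h ^ (p ^ k) ∈ U) ∧
      ∀ σ : absoluteGaloisGroup (IntermediateField.fixedField H : IntermediateField K (AlgebraicClosure K)),
        ∃ k : ℕ, (absGaloisRestrict K (IntermediateField.fixedField H :
          IntermediateField K (AlgebraicClosure K)) σ) ^ (p ^ k) ∈ U := by
  haveI := finiteIndex_of_isOpen U hU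
  haveI : Finite (absoluteGaloisGroup K ⧸ U) := Subgroup.finite_quotient_of_finiteIndex
  let P : Sylow p (absoluteGaloisGroup K ⧸ U) := default
  let H : Subgroup (absoluteGaloisGroup K) := (P : Subgroup (absoluteGaloisGroup K ⧸ U)).comap (QuotientGroup.mk' U)
  have hUH : U ≤ H := fun u hu => by
    change QuotientGroup.mk' U u ∈ (P : Subgroup (absoluteGaloisGroup K ⧸ U))
    rw [QuotientGroup.mk'_apply, (QuotientGroup.eq_one_iff u).mpr hu]
    exact one_mem _
  have hH : IsOpen (H : Set (absoluteGaloisGroup K)) := Subgroup.isOpen_mono hUH hU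
  -- every element of `H` has a `p`-power in `U`
  have hpowH : ∀ h ∈ H, ∃ k : ℕ, h ^ (p ^ k) ∈ U := fun h hh => by
    obtain ⟨k, hk⟩ := P.isPGroup' ⟨QuotientGroup.mk' U h, hh⟩
    refine ⟨k, ?_⟩
    have hk' : (QuotientGroup.mk' U h) ^ (p ^ k) = 1 := by
      have := congrArg Subtype.val hk
      simpa using this
    rwa [← map_pow, QuotientGroup.mk'_apply, QuotientGroup.eq_one_iff] at hk'
  refine ⟨H, hH, ?_, hpowH, fun σ => ?_⟩
  · rw [finrank_fixedField_of_isOpen H hH,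
      Subgroup.index_comap_of_surjective _ (QuotientGroup.mk'_surjective U)]
    haveI : (P : Subgroup (absoluteGaloisGroup K ⧸ U)).FiniteIndex := Subgroup.finiteIndex_of_finite
    exact (Nat.Prime.coprime_iff_not_dvd hp.out).mpr P.not_dvd_index
  · obtain ⟨g, hg⟩ := exists_mem_range_absGaloisRestrict_fixedField_iff H hH
    set γ := absGaloisRestrict K (IntermediateField.fixedField H : IntermediateField K (AlgebraicClosure K)) σ
    obtain ⟨k, hk⟩ := hpowH _ ((hg γ).mp ⟨σ, rfl⟩)
    refine ⟨k, ?_⟩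
    have hconj : (g⁻¹ * γ * g) ^ (p ^ k) = g⁻¹ * γ ^ (p ^ k) * g := by
      rw [show g⁻¹ * γ * g = g⁻¹ * γ * g⁻¹⁻¹ by rw [inv_inv], conj_pow, inv_inv]
    rw [hconj] at hk
    have := Subgroup.Normal.conj_mem inferInstance _ hk g
    rwa [show g * (g⁻¹ * γ ^ p ^ k * g) * g⁻¹ = γ ^ p ^ k by group] at this

end SylowField

/-! ## §4 Milne I Thm. 4.10(b) for modules of order `p²` -/

section Main

variable {K : Type} [Field K] [NumberField K] {p : ℕ} [hp : Fact p.Prime]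
variable {M : Type} [AddCommGroup M] [TopologicalSpace M] [DiscreteTopology M] [Finite M]

attribute [local instance] absoluteGaloisGroup_compactSpace

/-- **Milne I Thm. 4.10(b) `Ker γ¹ ⊆ Im β¹` for every finite discrete `Γ_K`-module `M` with `p · M = 0`
and `#M = p²`, `p` an odd prime, at every finite set of places `S` off which `p` and `M` are
unramified, for THE local Tate pairings.**  In particular for `M = E[p]`, `E` an elliptic curve over the
number field `K`.  Proof: dévissage over the `p`-Sylow fixed field (`middleExact_canonical_of_unipotentTwo_all`)
+ the prime-to-`p` descent (`middleExact_canonical_of_descentData`) with its nine binders.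
[cite: MilneADT2006, Ch. I, Thm. 4.10(b)] -/
theorem middleExact_canonical_of_card_eq_sq (hodd : Odd p) (ρ : DiscreteGaloisModule K M)
    (hpM : ∀ m : M, p • m = 0) (hcard : Nat.card M = p ^ 2)
    {S : Finset (Place K)}
    (hS : ∀ v : HeightOneSpectrum (𝓞 K), (Sum.inr v : Place K) ∉ S →
      ((p : ℕ) : 𝓞 K) ∉ v.asIdeal ∧ GaloisRep.IsUnramifiedAt v ρ)
    (t : Π v : Place K, galoisCohomology (ρ.toLocal v) 1)
    (horth : ∀ y : galoisCohomology (ρ.tateDual p) 1,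
      (∀ v : HeightOneSpectrum (𝓞 K), (Sum.inr v : Place K) ∉ S →
        galoisCohomology.localization (ρ.tateDual p) (Sum.inr v) 1 y ∈
          unramifiedSubgroup (GaloisRep.toLocal v (ρ.tateDual p)) 1) →
      ∑ v ∈ S, localTatePairingZMod ρ p v (LocalInvariants.canonical K p v) (t v)
        (galoisCohomology.localization (ρ.tateDual p) v 1 y) = 0) :
    ∃ x : galoisCohomology ρ 1,
      (∀ v : HeightOneSpectrum (𝓞 K), (Sum.inr v : Place K) ∉ S →
        galoisCohomology.localization ρ (Sum.inr v) 1 x ∈ unramifiedSubgroup (GaloisRep.toLocal v ρ) 1) ∧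
      ∀ v ∈ S, galoisCohomology.localization ρ v 1 x = t v := by
  haveI : NeZero p := ⟨hp.out.ne_zero⟩
  -- Step 1: the open normal subgroup `U` and the `p`-Sylow fixed field `K'' = K̄^H`
  haveI : (jointKer (p := p) ρ).Normal := MonoidHom.normal_ker _
  obtain ⟨H, hH, hcop, hpowH, hpowres⟩ :=
    exists_fixedField_coprime_pow_mem' (p := p) (jointKer (p := p) ρ) (isOpen_jointKer ρ)
  haveI : FiniteDimensional K (IntermediateField.fixedField H : IntermediateField K (AlgebraicClosure K)) :=
    finiteDimensional_fixedField_of_isOpen H hH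
  haveI : NumberField (IntermediateField.fixedField H : IntermediateField K (AlgebraicClosure K)) :=
    NumberField.of_module_finite K _
  -- Step 2: `Γ_{K''}` acts on `M` through elements of `p`-power order
  have hpowM : ∀ σ : absoluteGaloisGroup (IntermediateField.fixedField H : IntermediateField K (AlgebraicClosure K)),
      ∃ k : ℕ, ((ρ.restrictField (IntermediateField.fixedField H :
        IntermediateField K (AlgebraicClosure K))) σ) ^ (p ^ k) = 1 := fun σ => by
    obtain ⟨k, hk⟩ := hpowres σ
    refine ⟨k, ?_⟩
    rw [GaloisRep.restrictField_apply, ← map_pow]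
    exact LinearMap.ext fun m => ((mem_jointKer_iff (p := p) ρ _).mp hk).1 m
  -- `μₚ ⊂ K''`
  obtain ⟨ζ₀, hζ₀⟩ := HasEnoughRootsOfUnity.exists_primitiveRoot (AlgebraicClosure K) p
  set u₀ : (AlgebraicClosure K)ˣ := (hζ₀.isUnit hp.out.ne_zero).unit with hu₀def
  have hu₀val : (u₀ : AlgebraicClosure K) = ζ₀ := IsUnit.unit_spec _
  have hu₀ : u₀ ^ p = 1 := Units.ext (by
    rw [Units.val_pow_eq_pow_val, hu₀val, Units.val_one]; exact hζ₀.pow_eq_one)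
  have hζmem : ζ₀ ∈ (IntermediateField.fixedField H : IntermediateField K (AlgebraicClosure K)) := by
    rw [IntermediateField.mem_fixedField_iff]
    intro h hh
    obtain ⟨k, hk⟩ := hpowH h hh
    have hμk : ∀ z : MuCarrier K p, mu K p (h ^ (p ^ k)) z = z := ((mem_jointKer_iff (p := p) ρ _).mp hk).2
    have hu : ((mu K p).toRepresentation.asGroupHom h) ^ (p ^ k) = 1 := by
      rw [← map_pow]
      exact Units.ext (LinearMap.ext fun z => by rw [Representation.asGroupHom_apply]; exact hμk z)
    haveI : Finite (MuCarrier K p) :=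
      Nat.finite_of_card_ne_zero (by rw [natCard_muCarrier]; exact NeZero.ne p)
    have hz := units_apply_eq_self_of_pow_eq_one (natCard_muCarrier K p) _ hu (muOfUnit K p u₀ hu₀)
    rw [Representation.asGroupHom_apply] at hz
    have hval := congrArg (fun z => ((muVal K p z : (AlgebraicClosure K)ˣ) : AlgebraicClosure K)) hz
    simp only [muVal_muOfUnit, hu₀val] at hval
    exact hval
  have hζ : IsPrimitiveRoot (⟨ζ₀, hζmem⟩ :
      (IntermediateField.fixedField H : IntermediateField K (AlgebraicClosure K))) p :=
    (IsPrimitiveRoot.map_iff_of_injective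
      (f := algebraMap (IntermediateField.fixedField H : IntermediateField K (AlgebraicClosure K))
        (AlgebraicClosure K)) Subtype.val_injective).mp hζ₀
  -- Step 3: the unipotent filtration of `M|_{Γ_{K''}}` and Milne I 4.10(b) over `K''`
  obtain ⟨A, B, _, _, _, _, _, _, _, _, ρA, ρB, f, g, hA, hB, hcA, hcB, hpA, hpB, hSES⟩ :=
    exists_unipotentTwo_data (τ := ρ.restrictField (IntermediateField.fixedField H :
      IntermediateField K (AlgebraicClosure K))) hpM hcard hpowM
  haveI := DiscreteGaloisModule.TateDual.finite
    (IntermediateField.fixedField H : IntermediateField K (AlgebraicClosure K)) B p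
  -- Step 4: the descent
  refine middleExact_canonical_of_descentData (K' := (IntermediateField.fixedField H :
      IntermediateField K (AlgebraicClosure K))) ρ (ρ.restrictField _) hpM hcop
    (galoisCohomology.cor ρ _) (globalCorDual (p := p) ρ)
    (fun v w => localCor v w ρ) (fun v w => localRes v w ρ) (fun v w => localCorDual (p := p) ρ v w)
    (fun v y' => localization_cor_eq_sum_localCor v ρ y')
    (fun v y' => localization_globalCorDual_eq_sum_localCorDual v ρ y')
    (fun v a => sum_localCor_localRes v ρ a)
    (fun v w a b' => localTatePairingZMod_localRes_eq_localCorDual (p := p) ρ v w a b')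
    (fun v w z' hz' => localCor_mem_unramifiedSubgroup v w ρ z' hz')
    (fun v w z' hz' => localCorDual_mem_unramifiedSubgroup (p := p) ρ v w z' hz')
    (fun v w h => isUnramifiedAt_restrictField_place ρ v w h)
    (fun winf a => galoisCohomology_toLocal_inl_eq_zero_of_odd ρ hodd hpM winf a)
    (fun S' hS'inf hS' t' horth' => ?_) hS t horth
  exact middleExact_canonical_of_unipotentTwo_all (fun _ _ => hodd) hζ ρA (ρ.restrictField _) ρB
    hA hB hcA hcB hpA hpM hpB hSES hS'inf hS' t' horth'

end Main

end Summit.BirchSwinnertonDyer.BirchSwinnertonDyer.Theorems.KolyvaginRoadThreePT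

end
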